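import Literature.AlgebraicGeometry.GroupSchemes.GroupObjectOfPointwiseLaws
import Mathlib.AlgebraicGeometry.Pullbacks
import Mathlib.CategoryTheory.Monoidal.Cartesian.Over
import HarnessLib

/-!
# Group-scheme structures on `Y → T` (`GrpObj (Over.mk f)`) ⟷ scheme-level laws `m : Y ×_T Y → Y`, `e : T → Y`, `i : Y → Y` with pointwise axioms

Topic `Literature/AlgebraicGeometry/GroupSchemes`; namespace `Literature.AlgebraicGeometry.GroupSchemes`.  THEOREMS ONLY (no definition, no named fact, no
instance, no notation, no `sorry`); universe-polymorphic.  The DICTIONARY between Mathlib's group objects of the cartesian-monoidal `Over T` (the currency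
of ★ `AbelianSchemes/AbelianSchemeOverBase` and of the F-4 letters: `GrpObj (Over.mk (pullback.snd p v))`, `(MonObj.mul).left`, `(MonObj.one).left`) and
plain scheme morphisms: a multiplication `m : pullback f f ⟶ Y` over `T`, a unit SECTION `e : T ⟶ Y` and an inverse `i : Y ⟶ Y` over `T` satisfying the four
group axioms ON `W`-POINTS `a b c : W ⟶ Y` lying over the same `W ⟶ T` (`a·b := pullback.lift a b _ ≫ m`).  [SGA3] Exp. I 2.3.3 ∕ [MumfordFogartyKirwan1994]
Ch. 0 §1 (p. 2) (group pre-schemes = group functors); used in [MumfordFogartyKirwan1994] Ch. 6 §3, proof of Prop. 6.16 (p. 126), where the universal law of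
the law locus is handed over as a pair of morphisms satisfying identities (cell hodgecm-mathlib, FLOOR 0, P1 sub-line F-4 layer 2, sub-stub (II-c₁), B-p20 (g14)).

* **`exists_grpObj_overMk_of_laws`** — laws ⟹ `∃ G : GrpObj (Over.mk f)` with `(MonObj.mul).left = m`, `(MonObj.one).left = e`, `(GrpObj.inv).left = i`
  (★ `GroupSchemes.exists_grpObj_of_pointwise` in `Over T`; Mathlib `Over.lift_left`, `Over.toUnit_left`);
* **`laws_of_grpObj_overMk`** (and the honest-typed `laws_of_grpObj_overMk'`) — conversely every `G : GrpObj (Over.mk f)` yields the four pointwise identities for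
  `((MonObj.mul).left, (MonObj.one).left, (GrpObj.inv).left)`, plus the structure equations `mul.left ≫ f = fst ≫ f`, `one.left ≫ f = 𝟙`,
  `inv.left ≫ f = f` (`Over.w`).

HC_CM is proved only modulo the 7 printed citations until rung 0 closes; this file discharges none of them.

## References
* [SGA3] M. Demazure, A. Grothendieck, *Schémas en groupes I*, Exp. I, 2.3.3.
* [MumfordFogartyKirwan1994] D. Mumford, J. Fogarty, F. Kirwan, *Geometric Invariant Theory*, 3rd ed. (1994), Ch. 0 §1 (p. 2); Ch. 6 §3 Prop. 6.16, proof (p. 126).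
-/

set_option autoImplicit false

-- Mathlib's `Over`/pull-back API is stated across semireducible wrappers (as in the ★ `AbelianSchemes/*` files).
set_option backward.isDefEq.respectTransparency false

noncomputable section

open CategoryTheory CategoryTheory.Limits AlgebraicGeometry MonoidalCategory CartesianMonoidalCategory

universe u

namespace Literature.AlgebraicGeometry.GroupSchemes

variable {T Y : Scheme.{u}} {f : Y ⟶ T}

/-- **Group-scheme structure from scheme-level laws with pointwise axioms.**  Let `f : Y → T`, `m : Y ×_T Y → Y` over `T`, `e : T → Y` a section and
`i : Y → Y` over `T`, such that for all `a b c : W ⟶ Y` over the same `W → T`: `(a·b)·c = a·(b·c)`, `e·a = a`, `a·e = a`, `a⁻¹·a = e`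
(`a·b := pullback.lift a b _ ≫ m`, `e_W := (a ≫ f) ≫ e`, `a⁻¹ := a ≫ i`; the compatibility proofs of the `pullback.lift`s are universally quantified, so any
proof the consumer holds fits).  Then `Over.mk f` carries a `GrpObj` structure whose multiplication, unit and inverse have underlying morphisms EXACTLY `m`,
`e`, `i`. [cite: MumfordFogartyKirwan1994, Ch. 0 §1 (p. 2) and Ch. 6 §3 Proposition 6.16, proof (p. 126)] -/
theorem exists_grpObj_overMk_of_laws (m : pullback f f ⟶ Y) (hm : m ≫ f = pullback.fst f f ≫ f) (e : T ⟶ Y) (he : e ≫ f = 𝟙 T)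
    (i : Y ⟶ Y) (hi : i ≫ f = f)
    (hassoc : ∀ ⦃W : Scheme.{u}⦄ (a b c : W ⟶ Y) (hab : a ≫ f = b ≫ f) (hbc : b ≫ f = c ≫ f)
      (h₁ : (pullback.lift a b hab ≫ m) ≫ f = c ≫ f) (h₂ : a ≫ f = (pullback.lift b c hbc ≫ m) ≫ f),
      pullback.lift (pullback.lift a b hab ≫ m) c h₁ ≫ m = pullback.lift a (pullback.lift b c hbc ≫ m) h₂ ≫ m)
    (hone_mul : ∀ ⦃W : Scheme.{u}⦄ (a : W ⟶ Y) (h : ((a ≫ f) ≫ e) ≫ f = a ≫ f), pullback.lift ((a ≫ f) ≫ e) a h ≫ m = a)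
    (hmul_one : ∀ ⦃W : Scheme.{u}⦄ (a : W ⟶ Y) (h : a ≫ f = ((a ≫ f) ≫ e) ≫ f), pullback.lift a ((a ≫ f) ≫ e) h ≫ m = a)
    (hinv_mul : ∀ ⦃W : Scheme.{u}⦄ (a : W ⟶ Y) (h : (a ≫ i) ≫ f = a ≫ f), pullback.lift (a ≫ i) a h ≫ m = (a ≫ f) ≫ e) :
    ∃ G : GrpObj (Over.mk f),
      (@MonObj.mul _ _ _ (Over.mk f) G.toMonObj).left = m ∧ (@MonObj.one _ _ _ (Over.mk f) G.toMonObj).left = e ∧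
        (@GrpObj.inv _ _ _ (Over.mk f) G).left = i := by
  -- the three structure morphisms in `Over T`
  let m' : Over.mk f ⊗ Over.mk f ⟶ Over.mk f := Over.homMk m (by simpa using hm)
  let e' : 𝟙_ (Over T) ⟶ Over.mk f := Over.homMk e (by simpa using he)
  let i' : Over.mk f ⟶ Over.mk f := Over.homMk i (by simpa using hi)
  obtain ⟨G, hμ, hη, hι⟩ := exists_grpObj_of_pointwise (X := Over.mk f) m' e' i'
    (fun {W} a b c => Over.OverMorphism.ext (by
      simp only [Over.comp_left, Over.lift_left, m', Over.homMk_left]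
      exact hassoc a.left b.left c.left _ _ _ _))
    (fun {W} a => Over.OverMorphism.ext (by
      simp only [Over.comp_left, Over.lift_left, Over.toUnit_left, m', e', Over.homMk_left]
      have hw : W.hom = a.left ≫ f := by simpa using (Over.w a).symm
      simp only [hw, Category.assoc]
      exact hone_mul a.left _))
    (fun {W} a => Over.OverMorphism.ext (by
      simp only [Over.comp_left, Over.lift_left, Over.toUnit_left, m', e', Over.homMk_left]
      have hw : W.hom = a.left ≫ f := by simpa using (Over.w a).symm
      simp only [hw, Category.assoc]
      exact hmul_one a.left _))
    (fun {W} a => Over.OverMorphism.ext (by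
      simp only [Over.comp_left, Over.lift_left, Over.toUnit_left, m', e', i', Over.homMk_left]
      have hw : W.hom = a.left ≫ f := by simpa using (Over.w a).symm
      simp only [hw, Category.assoc]
      exact hinv_mul a.left _))
  refine ⟨G, ?_, ?_, ?_⟩
  · rw [hμ]; rfl
  · rw [hη]; rfl
  · rw [hι]; rfl

/-- **Scheme-level laws of a group-scheme structure.**  For `G : GrpObj (Over.mk f)` with `m := (MonObj.mul).left : Y ×_T Y → Y`,
`e := (MonObj.one).left : T → Y`, `i := (GrpObj.inv).left : Y → Y`: the structure equations `m ≫ f = fst ≫ f`, `e ≫ f = 𝟙`, `i ≫ f = f` and the four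
pointwise group identities, plus the right-inverse identity (`W`-points over the same `W → T`; compatibility proofs universally quantified). [cite: MumfordFogartyKirwan1994, Ch. 0 §1 (p. 2)] -/
theorem laws_of_grpObj_overMk (G : GrpObj (Over.mk f)) :
    (@MonObj.mul _ _ _ (Over.mk f) G.toMonObj).left ≫ f = pullback.fst f f ≫ f ∧
    (@MonObj.one _ _ _ (Over.mk f) G.toMonObj).left ≫ f = 𝟙 T ∧
    (@GrpObj.inv _ _ _ (Over.mk f) G).left ≫ f = f ∧
    (∀ ⦃W : Scheme.{u}⦄ (a b c : W ⟶ Y) (hab : a ≫ f = b ≫ f) (hbc : b ≫ f = c ≫ f)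
      (h₁ : (pullback.lift a b hab ≫ (@MonObj.mul _ _ _ (Over.mk f) G.toMonObj).left) ≫ f = c ≫ f)
      (h₂ : a ≫ f = (pullback.lift b c hbc ≫ (@MonObj.mul _ _ _ (Over.mk f) G.toMonObj).left) ≫ f),
      pullback.lift (pullback.lift a b hab ≫ (@MonObj.mul _ _ _ (Over.mk f) G.toMonObj).left) c h₁ ≫
          (@MonObj.mul _ _ _ (Over.mk f) G.toMonObj).left =
        pullback.lift a (pullback.lift b c hbc ≫ (@MonObj.mul _ _ _ (Over.mk f) G.toMonObj).left) h₂ ≫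
          (@MonObj.mul _ _ _ (Over.mk f) G.toMonObj).left) ∧
    (∀ ⦃W : Scheme.{u}⦄ (a : W ⟶ Y) (h : ((a ≫ f) ≫ (@MonObj.one _ _ _ (Over.mk f) G.toMonObj).left) ≫ f = a ≫ f),
      pullback.lift ((a ≫ f) ≫ (@MonObj.one _ _ _ (Over.mk f) G.toMonObj).left) a h ≫
          (@MonObj.mul _ _ _ (Over.mk f) G.toMonObj).left = a) ∧
    (∀ ⦃W : Scheme.{u}⦄ (a : W ⟶ Y) (h : a ≫ f = ((a ≫ f) ≫ (@MonObj.one _ _ _ (Over.mk f) G.toMonObj).left) ≫ f),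
      pullback.lift a ((a ≫ f) ≫ (@MonObj.one _ _ _ (Over.mk f) G.toMonObj).left) h ≫
          (@MonObj.mul _ _ _ (Over.mk f) G.toMonObj).left = a) ∧
    (∀ ⦃W : Scheme.{u}⦄ (a : W ⟶ Y) (h : (a ≫ (@GrpObj.inv _ _ _ (Over.mk f) G).left) ≫ f = a ≫ f),
      pullback.lift (a ≫ (@GrpObj.inv _ _ _ (Over.mk f) G).left) a h ≫ (@MonObj.mul _ _ _ (Over.mk f) G.toMonObj).left =
        (a ≫ f) ≫ (@MonObj.one _ _ _ (Over.mk f) G.toMonObj).left) ∧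
    (∀ ⦃W : Scheme.{u}⦄ (a : W ⟶ Y) (h : a ≫ f = (a ≫ (@GrpObj.inv _ _ _ (Over.mk f) G).left) ≫ f),
      pullback.lift a (a ≫ (@GrpObj.inv _ _ _ (Over.mk f) G).left) h ≫ (@MonObj.mul _ _ _ (Over.mk f) G.toMonObj).left =
        (a ≫ f) ≫ (@MonObj.one _ _ _ (Over.mk f) G.toMonObj).left) := by
  refine ⟨?_, ?_, ?_, fun W a b c hab hbc h₁ h₂ => ?_, fun W a h => ?_, fun W a h => ?_, fun W a h => ?_, fun W a h => ?_⟩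
  · simpa using Over.w (@MonObj.mul _ _ _ (Over.mk f) G.toMonObj)
  · simpa using Over.w (@MonObj.one _ _ _ (Over.mk f) G.toMonObj)
  · simpa using Over.w (@GrpObj.inv _ _ _ (Over.mk f) G)
  · -- associativity on the `W`-points `a, b, c` of `Over.mk (a ≫ f) ⟶ Over.mk f`
    have h := lift_lift_comp_mul_assoc' (X := Over.mk f) (T := Over.mk (a ≫ f)) (Over.homMk a rfl)
      (Over.homMk b hab.symm) (Over.homMk c (hbc.symm.trans hab.symm))
    have h' := congrArg CommaMorphism.left h
    simp only [Over.comp_left, Over.lift_left, Over.homMk_left] at h'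
    exact h'
  · have h := lift_toUnit_one_comp_mul (X := Over.mk f) (T := Over.mk (a ≫ f)) (Over.homMk a rfl)
    have h' := congrArg CommaMorphism.left h
    simp only [Over.comp_left, Over.lift_left, Over.homMk_left, Over.toUnit_left, Over.mk_hom] at h'
    exact h'
  · have h := lift_one_toUnit_comp_mul (X := Over.mk f) (T := Over.mk (a ≫ f)) (Over.homMk a rfl)
    have h' := congrArg CommaMorphism.left h
    simp only [Over.comp_left, Over.lift_left, Over.homMk_left, Over.toUnit_left, Over.mk_hom] at h'
    exact h'
  · have h := lift_inv_comp_mul (X := Over.mk f) (T := Over.mk (a ≫ f)) (Over.homMk a rfl)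
    have h' := congrArg CommaMorphism.left h
    simp only [Over.comp_left, Over.lift_left, Over.homMk_left, Over.toUnit_left, Over.mk_hom] at h'
    exact h'
  · have h := lift_comp_inv_mul (X := Over.mk f) (T := Over.mk (a ≫ f)) (Over.homMk a rfl)
    have h' := congrArg CommaMorphism.left h
    simp only [Over.comp_left, Over.lift_left, Over.homMk_left, Over.toUnit_left, Over.mk_hom] at h'
    exact h'

/-- **Honest-typed variant** of `laws_of_grpObj_overMk`: the three structure morphisms of a group object on `Over.mk f` as morphisms
of schemes `m : Y ×_T Y → Y`, `e : T → Y`, `i : Y → Y` (so that rewriting with their laws does not meet the monoidal objects of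
`Over T`). [cite: MumfordFogartyKirwan1994, Ch. 0 §1 (p. 2); Ch. 6 §1 Definition 6.1 (p. 115)] -/
theorem laws_of_grpObj_overMk' (G : GrpObj (Over.mk f)) :
    ∃ (m : pullback f f ⟶ Y) (e : T ⟶ Y) (i : Y ⟶ Y),
    (@MonObj.mul _ _ _ (Over.mk f) G.toMonObj).left = m ∧ (@MonObj.one _ _ _ (Over.mk f) G.toMonObj).left = e ∧
    (@GrpObj.inv _ _ _ (Over.mk f) G).left = i ∧
    m ≫ f = pullback.fst f f ≫ f ∧ e ≫ f = 𝟙 T ∧ i ≫ f = f ∧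
    (∀ ⦃W : Scheme.{u}⦄ (a b c : W ⟶ Y) (hab : a ≫ f = b ≫ f) (hbc : b ≫ f = c ≫ f)
      (h₁ : (pullback.lift a b hab ≫ m) ≫ f = c ≫ f) (h₂ : a ≫ f = (pullback.lift b c hbc ≫ m) ≫ f),
      pullback.lift (pullback.lift a b hab ≫ m) c h₁ ≫ m = pullback.lift a (pullback.lift b c hbc ≫ m) h₂ ≫ m) ∧
    (∀ ⦃W : Scheme.{u}⦄ (a : W ⟶ Y) (h : ((a ≫ f) ≫ e) ≫ f = a ≫ f), pullback.lift ((a ≫ f) ≫ e) a h ≫ m = a) ∧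
    (∀ ⦃W : Scheme.{u}⦄ (a : W ⟶ Y) (h : a ≫ f = ((a ≫ f) ≫ e) ≫ f), pullback.lift a ((a ≫ f) ≫ e) h ≫ m = a) ∧
    (∀ ⦃W : Scheme.{u}⦄ (a : W ⟶ Y) (h : (a ≫ i) ≫ f = a ≫ f), pullback.lift (a ≫ i) a h ≫ m = (a ≫ f) ≫ e) ∧
    (∀ ⦃W : Scheme.{u}⦄ (a : W ⟶ Y) (h : a ≫ f = (a ≫ i) ≫ f), pullback.lift a (a ≫ i) h ≫ m = (a ≫ f) ≫ e) :=
  ⟨_, _, _, rfl, rfl, rfl, laws_of_grpObj_overMk G⟩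

end Literature.AlgebraicGeometry.GroupSchemes

end
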